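import Literature.NumberTheory.ModularForms.PoincareSeriesWeightTwoPeterssonPairingCS
import Literature.NumberTheory.EllipticCurves.Gamma1NewformLSeriesProofs
import HarnessLib

/-!
# Cusp forms are square-integrable for the Petersson pairing of functions

Topic `Literature/NumberTheory/ModularForms` (namespace `Literature.NumberTheory.ModularForms.PoincareWeightTwo`,
continuing `PoincareSeriesWeightTwoHecke.lean`). THEOREMS ONLY. A cusp form `f ∈ S_k(Γ₀(N))` satisfies
`PeterssonSqIntegrable N k ⇑f` (the square-integrand `Σ_q |f(q⁻¹τ)|² (Im q⁻¹τ)ᵏ` is integrable on the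
standard fundamental domain): it is the real part of the integrand of the tree's `peterssonProduct f f`,
integrable by `integrableOn_sum_petersson_fd` (Diamond–Shurman §5.4, "the integral is well defined and
convergent"). Consequently Cauchy–Schwarz (`norm_peterssonPairing_le`) applies to pairings `⟨g, f⟩` of a
square-integrable `g` with a cusp form — the use made by the assembly stub T7 of the I1 fact skeleton
`Summits/Parity/GeneralizedHardyLittlewood/Cruxes/PeterssonBoundPrinted/Lines/poincare_hecke.lean`.

* `peterssonSqIntegrable_coe` — `PeterssonSqIntegrable N k ⇑f` for `f : CuspForm (Gamma0 N) k`.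
* `norm_peterssonPairing_coe_le` — `|⟨g, f⟩| ≤ √Re⟨g,g⟩ · √Re⟨f,f⟩_{Pet}` for square-integrable `g`.

## References

* [DiamondShurman2005] F. Diamond, J. Shurman, *A First Course in Modular Forms*, §5.4 (convergence of
  the Petersson integral for cusp forms).
* [IwaniecKowalski2004] H. Iwaniec, E. Kowalski, *Analytic Number Theory*, (14.11).
-/

noncomputable section

open scoped MatrixGroups Real
open CongruenceSubgroup Complex MeasureTheory
open UpperHalfPlane hiding I
open Literature.NumberTheory.EllipticCurves.ModularForms

namespace Literature.NumberTheory.ModularForms.PoincareWeightTwo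

/-- **A cusp form is square-integrable** in the sense of `PeterssonSqIntegrable` (the real part of the
integrand of `peterssonProduct f f`, integrable on `𝒟` by `integrableOn_sum_petersson_fd`).
[cite: DiamondShurman2005, §5.4 (before Def. 5.4.1)] -/
theorem peterssonSqIntegrable_coe (N : ℕ) [NeZero N] (k : ℤ) (f : CuspForm (Gamma0 N) k) :
    PeterssonSqIntegrable N k ⇑f := by
  letI := Fintype.ofFinite (𝒮ℒ ⧸ (Gamma0 N : Subgroup (GL (Fin 2) ℝ)).subgroupOf 𝒮ℒ)
  unfold PeterssonSqIntegrable
  have h := (integrableOn_sum_petersson_fd (Γ := Gamma0 N) (k := k) f f).re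
  refine h.congr (ae_of_all _ fun τ ↦ ?_)
  change RCLike.re (∑ q : 𝒮ℒ ⧸ (Gamma0 N : Subgroup (GL (Fin 2) ℝ)).subgroupOf 𝒮ℒ,
    petersson k ⇑f ⇑f (((q.out : 𝒮ℒ) : GL (Fin 2) ℝ)⁻¹ • τ)) = _
  rw [show (∑ q : 𝒮ℒ ⧸ (Gamma0 N : Subgroup (GL (Fin 2) ℝ)).subgroupOf 𝒮ℒ,
      petersson k ⇑f ⇑f (((q.out : 𝒮ℒ) : GL (Fin 2) ℝ)⁻¹ • τ)) =
      ((∑ q : 𝒮ℒ ⧸ (Gamma0 N : Subgroup (GL (Fin 2) ℝ)).subgroupOf 𝒮ℒ,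
        ‖f (((q.out : 𝒮ℒ) : GL (Fin 2) ℝ)⁻¹ • τ)‖ ^ 2 *
          ((((q.out : 𝒮ℒ) : GL (Fin 2) ℝ)⁻¹ • τ).im) ^ k : ℝ) : ℂ) by
    rw [Complex.ofReal_sum]
    exact Finset.sum_congr rfl fun q _ ↦ petersson_self_eq_ofReal k ⇑f _]
  exact Complex.ofReal_re _

/-- **Cauchy–Schwarz against a cusp form:** for square-integrable `g` and `f ∈ S_k(Γ₀(N))`,
`|⟨g, f⟩| ≤ √Re⟨g,g⟩ · √Re⟨f,f⟩`, the pairing being `peterssonPairing` (= `peterssonProduct` on cusp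
forms, `peterssonPairing_coe_eq`). [cite: IwaniecKowalski2004, (14.11)] -/
theorem norm_peterssonPairing_coe_le (N : ℕ) [NeZero N] (k : ℤ) (g : ℍ → ℂ)
    (hg : PeterssonSqIntegrable N k g) (f : CuspForm (Gamma0 N) k) :
    ‖peterssonPairing N k g ⇑f‖ ≤
      Real.sqrt ((peterssonPairing N k g g).re) * Real.sqrt ((peterssonPairing N k ⇑f ⇑f).re) :=
  norm_peterssonPairing_le g ⇑f hg (peterssonSqIntegrable_coe N k f)

end Literature.NumberTheory.ModularForms.PoincareWeightTwo

end
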